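import Summits.CriticalPhenomena.PercolationContinuityZ3.Theorems.PercNearOneGluingNoHeavyLowerTailSunflowerMultiPetalRankCertificate
import HarnessLib
import HarnessLib.Audit

/-!
# `NoHeavyLowerTail` (crux stmt-CriticalPhenomena-4575), abstract sunflower cubic, `k` petals: REFUTATION of the rank certificate conjecture
# `RankCertificateK` (…SunflowerMultiPetalRankCertificate) by a six-point, five-petal labelling

Support file (seat `prim-l12-p2` gen 28; `--supports stmt-CriticalPhenomena-4575`; COMPUTATIONAL: `native_decide` for one vanishing linear combination in `ℚ^(rows × Fin 6)`
and for the finite structure checks of the witness).  Memo: run/shared/lean/prim/prim-l12/prim-l12-p2/FINDING-g28-RANK-CERTIFICATE.md §10.  Found the same session by an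
adversarial local search on six points (work/c/adv7.c) after the conjecture had passed the EXHAUSTIVE five-point census (178 060 instances); the multi-petal partition lemma
itself (`PartitionLemmaK`) and the doubled-cube Hall form `DoubledCubeHallK` hold on the witness.

THE WITNESS (`cxF : MSunflower 5 (Fin 6)`).  Kernel `A` = up-closure of {0123, 0124, 0234, 1234, 015, 125, 135, 0235, 145, 0245, 0345, 2345}; petals (= Hasse components of the
middle zone) `C₀` = {1, 01, 12, 012, 13, 013, 123, 14, 014, 124, 034, 134, 0134, 15}, `C₁` = {023}, `C₂` = {024}, `C₃` = {234}, `C₄` = {05, 25, 025, 35, 035, 235, 45, 045, 245, 345};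
bottom = the rest (∅, 0, 2, 02, 3, 03, 23, 4, 04, 24, 34, 5).  Its three rainbows {1 | 234 | 05}, {1 | 024 | 35}, {1 | 023 | 45} share the least block {1}; the rainbow columns
of the first two differ by a signed sum of fourteen pair columns (seven in the cube {0}, seven in the cube {3}) and two pseudo columns (`dependency`), an explicit ±1 relation
with 18 terms: the certificate family has rank `#family − 2`.

* `not_rankCertificateK : ¬ RankCertificateK`.
-/

set_option maxRecDepth 100000

namespace Summit.CriticalPhenomena.PercolationContinuityZ3.Theorems.SunflowerPartition

open Finset

namespace RankCertificateRefutation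

/-- Minimal kernel sets of the witness. [this work] -/
def LA : List (Finset (Fin 6)) :=
  [{0, 1, 2, 3}, {0, 1, 2, 4}, {0, 2, 3, 4}, {1, 2, 3, 4}, {0, 1, 5}, {1, 2, 5}, {1, 3, 5}, {0, 2, 3, 5}, {1, 4, 5}, {0, 2, 4, 5}, {0, 3, 4, 5}, {2, 3, 4, 5}]

/-- The kernel: up-closure of `LA` (a closed term, evaluated once by compiled code). [this work] -/
def cxA : Finset (Finset (Fin 6)) := univ.filter fun S => LA.any fun m => m ⊆ S

/-- Petal up-set `V 0 = A ∪ C₀`, `C₀` = {1, 01, 12, 012, 13, 013, 123, 14, 014, 124, 034, 134, 0134, 15}. [this work] -/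
def cxV0 : Finset (Finset (Fin 6)) :=
  cxA ∪ {{1}, {0, 1}, {1, 2}, {0, 1, 2}, {1, 3}, {0, 1, 3}, {1, 2, 3}, {1, 4}, {0, 1, 4}, {1, 2, 4}, {0, 3, 4}, {1, 3, 4}, {0, 1, 3, 4}, {1, 5}}
/-- Petal up-set `V 1 = A ∪ {023}`. [this work] -/
def cxV1 : Finset (Finset (Fin 6)) := cxA ∪ {{0, 2, 3}}
/-- Petal up-set `V 2 = A ∪ {024}`. [this work] -/
def cxV2 : Finset (Finset (Fin 6)) := cxA ∪ {{0, 2, 4}}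
/-- Petal up-set `V 3 = A ∪ {234}`. [this work] -/
def cxV3 : Finset (Finset (Fin 6)) := cxA ∪ {{2, 3, 4}}
/-- Petal up-set `V 4 = A ∪ C₄`, `C₄` = {05, 25, 025, 35, 035, 235, 45, 045, 245, 345}. [this work] -/
def cxV4 : Finset (Finset (Fin 6)) :=
  cxA ∪ {{0, 5}, {2, 5}, {0, 2, 5}, {3, 5}, {0, 3, 5}, {2, 3, 5}, {4, 5}, {0, 4, 5}, {2, 4, 5}, {3, 4, 5}}

/-- The petal up-sets (five closed terms). [this work] -/
def cxV (i : Fin 5) : Finset (Finset (Fin 6)) := ![cxV0, cxV1, cxV2, cxV3, cxV4] i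

/-- The petal up-sets are up-sets (finite check). [this work] -/
theorem cxV_upper : ∀ i : Fin 5, ∀ S T : Finset (Fin 6), S ⊆ T → S ∈ cxV i → T ∈ cxV i := by native_decide

/-- The kernel is an up-set (finite check). [this work] -/
theorem cxA_upper : ∀ S T : Finset (Fin 6), S ⊆ T → S ∈ cxA → T ∈ cxA := by native_decide

/-- The kernel lies in every petal up-set. [this work] -/
theorem cxA_sub : ∀ i : Fin 5, cxA ⊆ cxV i := by
  intro i; fin_cases i <;> exact subset_union_left

/-- Distinct petal up-sets meet inside the kernel (finite check). [this work] -/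
theorem cxV_inter : ∀ i j : Fin 5, i ≠ j → ∀ S : Finset (Fin 6), S ∈ cxV i → S ∈ cxV j → S ∈ cxA := by native_decide

/-- **The witness**: a six-point labelling with five petal components. [this work] -/
def cxF : MSunflower 5 (Fin 6) where
  V := cxV
  A := cxA
  upperV := fun i S T hST hS => cxV_upper i S T hST hS
  upperA := fun S T hST hS => cxA_upper S T hST hS
  A_sub := cxA_sub
  inter_sub := fun i j hij S hS => cxV_inter i j hij S (mem_inter.1 hS).1 (mem_inter.1 hS).2

/-- The sixteen bad ordered partitions (tag-0 orderings: `(Q, P)` for the fourteen pairs, `(F¹, F²)` for the two rainbows) and their coefficients. [this work] -/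
def badList : List ((Finset (Fin 6) × Finset (Fin 6)) × ℚ) :=
  [(({0}, {1, 5}), 1), (({0}, {1, 3, 4}), 1), (({0}, {1, 2, 4}), 1), (({0}, {1, 4}), -1), (({0}, {1, 2, 3}), 1), (({0}, {1, 3}), -1), (({0}, {1, 2}), -1),
   (({3}, {1, 2, 4}), -1), (({3}, {1, 5}), -1), (({3}, {0, 1, 4}), -1), (({3}, {1, 4}), 1), (({3}, {0, 1, 2}), -1), (({3}, {1, 2}), 1), (({3}, {0, 1}), 1),
   (({1}, {2, 3, 4}), -1), (({1}, {0, 2, 4}), 1)]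

/-- Coefficient of a bad ordered partition. [this work] -/
def coeffBad (q : Finset (Fin 6) × Finset (Fin 6)) : ℚ := ((badList.find? fun e => e.1 = q).map Prod.snd).getD 0

/-- Coefficients on the pseudo columns (rows `(K, R)` = ({0,1,5}, {2,3,4}) and ({1,3,5}, {0,2,4}), carved block `∅`). [this work] -/
def coeffPseudo (p : Finset (Fin 6) × Finset (Fin 6)) : ℚ :=
  if p = ({0, 1, 5}, {2, 3, 4}) then 1 else if p = ({1, 3, 5}, {0, 2, 4}) then -1 else 0

/-- The coefficient function of the dependency on the certificate index type (tag-0 copy only). [this work] -/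
def coeff : cxF.CertIndex → ℚ
  | Sum.inl q => coeffBad q.1
  | Sum.inr (p, i) => if i = 0 then coeffPseudo p.1 else 0

/-- All members of `badList` are bad ordered partitions of the witness (compiled check). [this work] -/
theorem badList_mem : ∀ e ∈ badList, e.1 ∈ cxF.badParts := by native_decide

/-- The two pseudo rows of the dependency are pseudo rows of the witness (compiled check). [this work] -/
theorem pseudo_mem : (({0, 1, 5}, {2, 3, 4}) : Finset (Fin 6) × Finset (Fin 6)) ∈ cxF.pseudoRows ∧
    (({1, 3, 5}, {0, 2, 4}) : Finset (Fin 6) × Finset (Fin 6)) ∈ cxF.pseudoRows := by native_decide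

/-- The support of the dependency as a finset of certificate indices. [this work] -/
def supp : Finset cxF.CertIndex :=
  (badList.attach.map fun e => (Sum.inl ⟨e.1.1, badList_mem e.1 e.2⟩ : cxF.CertIndex)).toFinset ∪
    {Sum.inr (⟨({0, 1, 5}, {2, 3, 4}), pseudo_mem.1⟩, 0), Sum.inr (⟨({1, 3, 5}, {0, 2, 4}), pseudo_mem.2⟩, 0)}

/-- **The dependency**: the signed combination of the eighteen certificate vectors vanishes (one compiled evaluation over `rowSet × Fin 6`). [this work] -/
theorem dependency : (∑ i ∈ supp, coeff i • cxF.certVec i) = 0 := by native_decide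

/-- The rainbow `({1}, {2,3,4})` (third block `{0,5}`) is a bad ordered partition of the witness. [this work] -/
theorem rb_mem : (({1}, {2, 3, 4}) : Finset (Fin 6) × Finset (Fin 6)) ∈ cxF.badParts := by native_decide

/-- The rainbow index lies in the support. [this work] -/
theorem rb_mem_supp : (Sum.inl ⟨({1}, {2, 3, 4}), rb_mem⟩ : cxF.CertIndex) ∈ supp := by native_decide

/-- Its coefficient in the dependency is `−1`. [this work] -/
theorem coeff_rb : coeff (Sum.inl ⟨({1}, {2, 3, 4}), rb_mem⟩) = -1 := by native_decide

end RankCertificateRefutation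

open RankCertificateRefutation in
/-- **The rank certificate conjecture is FALSE** (six points, five petals): the certificate family of the witness `cxF` satisfies the explicit nontrivial relation
`dependency`, so it is not linearly independent. [this work] -/
theorem not_rankCertificateK : ¬ RankCertificateK := by
  intro h
  have hli := h 5 (Fin 6) cxF
  have hzero := (linearIndependent_iff'.mp hli) supp coeff dependency _ rb_mem_supp
  rw [coeff_rb] at hzero
  norm_num at hzero

end Summit.CriticalPhenomena.PercolationContinuityZ3.Theorems.SunflowerPartition
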